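import Mathlib
import Summits.KontsevichZagierPeriods.Zeta5Search.DenomLaw.ConjugateRaiseLawProof
import Summits.KontsevichZagierPeriods.Zeta5Search.DenomLaw.RuleRABTopCellCR
import Summits.KontsevichZagierPeriods.Zeta5Search.DenomLaw.RuleRABTopCellN1
import HarnessLib

/-!
# ζ(5) search — DENOM-LAW: rule R2 on the census's A/B family is UNCONDITIONAL for `t ≥ 8` (all `n`) and for `t = 7`, `n = 1` — prover-d1 gen 3

HONEST FRAMING: systematic search; no irrationality claim unless certified.  Cell `pub-zeta5`, track «DENOM-LAW», seat `denom-prover-d1`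
gen 3 (ATTEMPT-4).  `p`-adic valuation bounds for the explicit rationals `Cas₇(b) = W(b+e₇)V(b) − W(b)V(b+e₇)` on the linear rays
`b = bLin (t n) (t n + 2n) n = n·(3t+14; t+6, t+8, t+8, t+7, t+10, t+14, t+16, t+11)`-dual = `n·(3t+14; t+6,…,t)` (the census's A/B
family: A14, A15, A16, A18, B20 are `t = 11, 12, 13, 15, 17`); nothing about ζ(5); no model exponent is asserted here; records in print UNMOVED.

With `DenomLaw.conjugateRaiseLaw_holds` (file `ConjugateRaiseLawProof.lean`, this seat) the conditional theorems of gen 2 —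
`RuleRAB.cell2_of_CR` (top cell `(t+2)n < p ≤ (t+3)n`, value `−13`, all `t ≥ 8`, all `n ≥ 1`), `RuleRAB.ruleR2_strip_of_CR` (the whole
five-cell rule-R2 strip `(t+2)n < p ≤ (t+7)n` at engine-d2's RULE R2 values `−13, −13, −13, −12, −11`) and `RuleRAB.cell2_n1_of_CR`
(top cell, `t ≥ 7`, `n = 1`) — become UNCONDITIONAL: `cell2_top`, `ruleR2_strip`, `cell2_top_n1`.  By name: `RuleR2ABTopCell`
(statement file `RuleRABFamily.lean`, threshold `t ≥ 7`) is thereby proved for every `(t, n)` with `t ≥ 8` or `n = 1`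
(`ruleR2ABTopCell_of_eight_le`, `ruleR2ABTopCell_of_n_one`); the remaining case `t = 7`, `n ≥ 2` (sub-deep 3-point classes `[0,−6,−2]`
outside hypothesis (H2) of the law) stays OBSERVED (exact instances `(t,n,p) = (7,2,19)`: `−13`).  The A18 / B20 five-cell corollaries
are restated with the top cell at `−13` (`a18_cells'`, `b20_cells'`).  ACCOUNTING (MODEL side, not a γ claim): on every family member with
`t ≥ 8` the five unit cells of rule R2 — 5 nats/n above the PATH/(28)+(30) exponent in engine-d2's table — are now all-`n` tree theorems.
-/

namespace Summit.KontsevichZagierPeriods.Zeta5Search.RuleRAB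

open Summit.KontsevichZagierPeriods.Zeta5Search.CasoratianValuation (casoratian)
open Summit.KontsevichZagierPeriods.Zeta5Search.CellKit (bLin)
open Summit.KontsevichZagierPeriods.Zeta5Search.DenomLaw

/-- **Top rule-R2 cell, unconditional**: `8 ≤ t → 1 ≤ n → p prime → (t+2)n < p ≤ (t+3)n → Cas₇ ≠ 0 → −13 ≤ v_p(Cas₇(bLin (tn) (tn+2n) n))`. -/
theorem cell2_top (t n p : ℕ) (ht : 8 ≤ t) (hn : 1 ≤ n) (hp : p.Prime) (hA : t * n + 2 * n < p) (hB : p ≤ t * n + 3 * n)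
    (hne : casoratian (bLin (t * n) (t * n + 2 * n) n) 7 ≠ 0) :
    (-13 : ℤ) ≤ padicValRat p (casoratian (bLin (t * n) (t * n + 2 * n) n) 7) :=
  cell2_of_CR conjugateRaiseLaw_holds t n p ht hn hp hA hB hne

/-- **Top rule-R2 cell at `n = 1`, unconditional, all `t ≥ 7`.** -/
theorem cell2_top_n1 (t n p : ℕ) (hn1 : n = 1) (ht : 7 ≤ t) (hp : p.Prime) (hA : t * n + 2 * n < p) (hB : p ≤ t * n + 3 * n)
    (hne : casoratian (bLin (t * n) (t * n + 2 * n) n) 7 ≠ 0) :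
    (-13 : ℤ) ≤ padicValRat p (casoratian (bLin (t * n) (t * n + 2 * n) n) 7) :=
  cell2_n1_of_CR conjugateRaiseLaw_holds t n p hn1 ht hp hA hB hne

/-- **The five-cell rule-R2 strip, unconditional** (`t ≥ 8`, all `n ≥ 1`): values `−13, −13, −13, −12, −11` on the unit cells
`θ = p/n ∈ (t+2, t+3], (t+3, t+4], (t+4, t+5], (t+5, t+6], (t+6, t+7]`. -/
theorem ruleR2_strip (t n p : ℕ) (ht : 8 ≤ t) (hn : 1 ≤ n) (hp : p.Prime)
    (hne : casoratian (bLin (t * n) (t * n + 2 * n) n) 7 ≠ 0) :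
    (t * n + 2 * n < p → p ≤ t * n + 3 * n → (-13 : ℤ) ≤ padicValRat p (casoratian (bLin (t * n) (t * n + 2 * n) n) 7)) ∧
    (t * n + 3 * n < p → p ≤ t * n + 4 * n → (-13 : ℤ) ≤ padicValRat p (casoratian (bLin (t * n) (t * n + 2 * n) n) 7)) ∧
    (t * n + 4 * n < p → p ≤ t * n + 5 * n → (-13 : ℤ) ≤ padicValRat p (casoratian (bLin (t * n) (t * n + 2 * n) n) 7)) ∧
    (t * n + 5 * n < p → p ≤ t * n + 6 * n → (-12 : ℤ) ≤ padicValRat p (casoratian (bLin (t * n) (t * n + 2 * n) n) 7)) ∧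
    (t * n + 6 * n < p → p ≤ t * n + 7 * n → (-11 : ℤ) ≤ padicValRat p (casoratian (bLin (t * n) (t * n + 2 * n) n) 7)) :=
  ruleR2_strip_of_CR conjugateRaiseLaw_holds t n p ht hn hp hne

/-- **`RuleR2ABTopCell` for `t ≥ 8`** (the statement-file form, all `n ≥ 1`). -/
theorem ruleR2ABTopCell_of_eight_le : ∀ t n p : ℕ, 8 ≤ t → 1 ≤ n → p.Prime → t * n + 2 * n < p → p ≤ t * n + 3 * n →
    casoratian (bLin (t * n) (t * n + 2 * n) n) 7 ≠ 0 →
      (-13 : ℤ) ≤ padicValRat p (casoratian (bLin (t * n) (t * n + 2 * n) n) 7) :=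
  fun t n p ht hn hp hA hB hne => cell2_top t n p ht hn hp hA hB hne

/-- **`RuleR2ABTopCell` at `n = 1`** (all `t ≥ 7`). -/
theorem ruleR2ABTopCell_of_n_one : ∀ t p : ℕ, 7 ≤ t → p.Prime → t * 1 + 2 * 1 < p → p ≤ t * 1 + 3 * 1 →
    casoratian (bLin (t * 1) (t * 1 + 2 * 1) 1) 7 ≠ 0 →
      (-13 : ℤ) ≤ padicValRat p (casoratian (bLin (t * 1) (t * 1 + 2 * 1) 1) 7) :=
  fun t p ht hp hA hB hne => cell2_top_n1 t 1 p rfl ht hp hA hB hne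

/-- **A18, all five rule-R2 cells at rule R2's values** (`t = 15`, dual ray `n·(59; 21,…,15)`; top cell `17n < p ≤ 18n` now `−13`). -/
theorem a18_cells' (n p : ℕ) (hn : 1 ≤ n) (hp : p.Prime) (hne : casoratian (bLin (15 * n) (15 * n + 2 * n) n) 7 ≠ 0) :
    (17 * n < p → p ≤ 18 * n → (-13 : ℤ) ≤ padicValRat p (casoratian (bLin (15 * n) (15 * n + 2 * n) n) 7)) ∧
    (18 * n < p → p ≤ 19 * n → (-13 : ℤ) ≤ padicValRat p (casoratian (bLin (15 * n) (15 * n + 2 * n) n) 7)) ∧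
    (19 * n < p → p ≤ 20 * n → (-13 : ℤ) ≤ padicValRat p (casoratian (bLin (15 * n) (15 * n + 2 * n) n) 7)) ∧
    (20 * n < p → p ≤ 21 * n → (-12 : ℤ) ≤ padicValRat p (casoratian (bLin (15 * n) (15 * n + 2 * n) n) 7)) ∧
    (21 * n < p → p ≤ 22 * n → (-11 : ℤ) ≤ padicValRat p (casoratian (bLin (15 * n) (15 * n + 2 * n) n) 7)) := by
  obtain ⟨h2, h3, h4, h5, h6⟩ := ruleR2_strip 15 n p (by norm_num) hn hp hne
  exact ⟨fun hA hB => h2 (by omega) (by omega), fun hA hB => h3 (by omega) (by omega), fun hA hB => h4 (by omega) (by omega),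
    fun hA hB => h5 (by omega) (by omega), fun hA hB => h6 (by omega) (by omega)⟩

/-- **B20, all five rule-R2 cells at rule R2's values** (`t = 17`, dual ray `n·(65; 23,…,17)`; top cell `19n < p ≤ 20n` now `−13`). -/
theorem b20_cells' (n p : ℕ) (hn : 1 ≤ n) (hp : p.Prime) (hne : casoratian (bLin (17 * n) (17 * n + 2 * n) n) 7 ≠ 0) :
    (19 * n < p → p ≤ 20 * n → (-13 : ℤ) ≤ padicValRat p (casoratian (bLin (17 * n) (17 * n + 2 * n) n) 7)) ∧
    (20 * n < p → p ≤ 21 * n → (-13 : ℤ) ≤ padicValRat p (casoratian (bLin (17 * n) (17 * n + 2 * n) n) 7)) ∧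
    (21 * n < p → p ≤ 22 * n → (-13 : ℤ) ≤ padicValRat p (casoratian (bLin (17 * n) (17 * n + 2 * n) n) 7)) ∧
    (22 * n < p → p ≤ 23 * n → (-12 : ℤ) ≤ padicValRat p (casoratian (bLin (17 * n) (17 * n + 2 * n) n) 7)) ∧
    (23 * n < p → p ≤ 24 * n → (-11 : ℤ) ≤ padicValRat p (casoratian (bLin (17 * n) (17 * n + 2 * n) n) 7)) := by
  obtain ⟨h2, h3, h4, h5, h6⟩ := ruleR2_strip 17 n p (by norm_num) hn hp hne
  exact ⟨fun hA hB => h2 (by omega) (by omega), fun hA hB => h3 (by omega) (by omega), fun hA hB => h4 (by omega) (by omega),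
    fun hA hB => h5 (by omega) (by omega), fun hA hB => h6 (by omega) (by omega)⟩

end Summit.KontsevichZagierPeriods.Zeta5Search.RuleRAB
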